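import Mathlib.FieldTheory.Finite.Polynomial
import Mathlib.RingTheory.MvPolynomial.Basic
import Mathlib.Algebra.Polynomial.Degree.Domain
import Literature.NumberTheory.EllipticCurves.FormalGroupChart
import Literature.NumberTheory.EllipticCurves.DivisionPolynomialFormalMulProofs
import Literature.NumberTheory.EllipticCurves.TorsionCardinality
import HarnessLib

/-! # Crude bound on the parameter of an `N`-torsion point of the kernel of reduction — stub
# `stub_crudeBound` of line `Sketch`, crux `MazurKenkuBound` (stmt-ABC-15125)

WHAT. For a `w`-integral Weierstrass equation `V` over a valued field `(F, w)`, an odd prime `N`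
with `N ≠ 0` in `F`, and an affine `N`-torsion point `(x, y)` of the kernel of reduction
(`|x| > 1`): `|N| ≤ |z|^{N-1}` for the parameter `z = -x/y` (i.e. `ord z ≤ ord N / (N - 1)`,
Mazur 1978, proof of Prop. 5.1; Silverman AEC IV.6.1 / VII.3.4 in Newton-polygon form).

PROOF. (1) `x` is a root of `ψ_N = preΨ'_N = N X^{(N²-1)/2} + ⋯` (`[N]P = O ↔ ΨSq_N(x) = 0`,
`ΨSq_N = preΨ'_N²` for odd `N`).  (2) All coefficients of `preΨ'_N` are `w`-integral (integral
model).  (3) THE KEY LEMMA, universal: the coefficients of `preΨ'_N` in degrees `> (N² - N)/2`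
are multiples of `N` — in characteristic `N` the tree's identity
`(Σᵢ ΨSq_N[i] uⁱ z^{2(N²-1-i)}) · z² · u([N](z)) = (Σᵢ Φ_N[i] uⁱ z^{2(N²-i)}) · [N](z)²` (∗)
(`sum_ΨSq_mul_formalXMulSq_subst_formalMul`) together with `[N](z) = z^N · h(z)`
(`exists_formalMul_prime_eq_X_pow_mul`, Katz–Mazur 12.4.2 / AEC IV.4.4) forces
`deg ΨSq_N ≤ N² - N` (compare orders of vanishing at `z = 0`); over the domain `𝔽_N[a₁,…,a₆]`
this gives `deg preΨ'_N ≤ (N² - N)/2` for the reduction of the universal equation, i.e. the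
universal coefficients above that degree are `≡ 0 (mod N)` in `ℤ[aᵢ]`, and every equation is a
specialisation of the universal one.  (4) Ultrametric bookkeeping: the top term `N x^D`,
`D = (N²-1)/2`, strictly dominates every term of degree in `((N²-N)/2, D)`, so (as the sum
vanishes) some term of degree `i ≤ (N²-N)/2` has `|N| |x|^D ≤ |x|^i`, whence
`|N| |x|^{(N-1)/2} ≤ 1`; finally `|x| |z|² = 1` on the kernel of reduction. -/

-- `Summit.<Summit>.<Problem>` is the mandated summit-side namespace (CONVENTIONS §2); for the
-- single-conjunct summit `ABC` the two coincide, so the duplicate `ABC.ABC` is deliberate.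
set_option linter.dupNamespace false

noncomputable section

open scoped NNReal Classical
open WeierstrassCurve Literature.NumberTheory.EllipticCurves

namespace Summit.ABC.ABC.Theorems

/-- **`deg ΨSq_ℓ ≤ ℓ² - ℓ` in odd prime characteristic `ℓ`**, for every Weierstrass equation over
every commutative ring of characteristic `ℓ` (no ordinarity or domain hypothesis): in (∗) the right
side is divisible by `z^{2ℓ}` (`[ℓ](z) = z^ℓ · h`), the cofactor `u([ℓ](z))` has constant term `1`,
and the left sum is `z^{2(ℓ²-1-D)} · (c + O(z))` with `D = deg ΨSq_ℓ`, `c` its leading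
coefficient; so `2(ℓ² - 1 - D) + 2 ≥ 2ℓ`.  (The division-polynomial form of "`ψ_ℓ mod ℓ` has
degree `≤ (ℓ² - ℓ)/2`", Katz–Mazur 12.4.2.) [cite: SilvermanAEC2009, Exercise 3.7 and IV.4.4] -/
private theorem natDegree_ΨSq_le_of_charP {S : Type*} [CommRing S] (ℓ : ℕ) [Fact ℓ.Prime]
    [CharP S ℓ] (V : WeierstrassCurve S) (hℓ2 : ℓ ≠ 2) : (V.ΨSq ℓ).natDegree ≤ ℓ ^ 2 - ℓ := by
  have hℓ : ℓ.Prime := Fact.out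
  have hℓ1 : 1 ≤ ℓ ^ 2 := Nat.one_le_pow _ _ hℓ.pos
  by_cases hΨ0 : V.ΨSq ℓ = 0
  · rw [hΨ0, Polynomial.natDegree_zero]; exact Nat.zero_le _
  have key := V.sum_ΨSq_mul_formalXMulSq_subst_formalMul ℓ
  obtain ⟨h, hh, -⟩ := V.exists_formalMul_prime_eq_X_pow_mul ℓ hℓ2
  set D := (V.ΨSq ℓ).natDegree with hD
  set c := (V.ΨSq ℓ).leadingCoeff with hc
  have hDle : D ≤ ℓ ^ 2 - 1 := by
    have := V.natDegree_ΨSq_le ℓ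
    rwa [Int.natAbs_natCast] at this
  have hc0 : c ≠ 0 := Polynomial.leadingCoeff_ne_zero.mpr hΨ0
  -- `u([ℓ](z))` has constant coefficient `1`
  have hu1 : PowerSeries.constantCoeff (V.formalXMulSq.subst (V.formalMul ℓ)) = 1 := by
    rw [constantCoeff_subst_eq_constantCoeff (V.constantCoeff_formalMul ℓ),
      constantCoeff_formalXMulSq]
  -- the right side is `X^{2ℓ} · G`
  have hR : (∑ i ∈ Finset.range (ℓ ^ 2 + 1),
      PowerSeries.C ((V.Φ ℓ).coeff i) * V.formalXMulSq ^ i * PowerSeries.X ^ (2 * (ℓ ^ 2 - i))) *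
        V.formalMul ℓ ^ 2 = PowerSeries.X ^ (2 * ℓ) * ((∑ i ∈ Finset.range (ℓ ^ 2 + 1),
      PowerSeries.C ((V.Φ ℓ).coeff i) * V.formalXMulSq ^ i * PowerSeries.X ^ (2 * (ℓ ^ 2 - i))) *
        h ^ 2) := by
    rw [hh]; ring
  -- the left sum is `X^{2(ℓ²-1-D)} · B` with `B(0) = c`
  have hL : (∑ i ∈ Finset.range (ℓ ^ 2),
      PowerSeries.C ((V.ΨSq ℓ).coeff i) * V.formalXMulSq ^ i *
        PowerSeries.X ^ (2 * (ℓ ^ 2 - 1 - i))) =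
        PowerSeries.X ^ (2 * (ℓ ^ 2 - 1 - D)) * ∑ i ∈ Finset.range (D + 1),
      PowerSeries.C ((V.ΨSq ℓ).coeff i) * V.formalXMulSq ^ i * PowerSeries.X ^ (2 * (D - i)) := by
    rw [Finset.mul_sum, ← Finset.sum_subset (Finset.range_subset_range.mpr (by omega : D + 1 ≤ ℓ ^ 2))]
    · refine Finset.sum_congr rfl fun i hi => ?_
      rw [Finset.mem_range] at hi
      have e : 2 * (ℓ ^ 2 - 1 - i) = 2 * (ℓ ^ 2 - 1 - D) + 2 * (D - i) := by omega
      rw [e, pow_add]; ring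
    · intro i _ hnot
      rw [Finset.mem_range, not_lt] at hnot
      rw [Polynomial.coeff_eq_zero_of_natDegree_lt (by omega), map_zero, zero_mul, zero_mul]
  have hB0 : PowerSeries.constantCoeff (∑ i ∈ Finset.range (D + 1),
      PowerSeries.C ((V.ΨSq ℓ).coeff i) * V.formalXMulSq ^ i * PowerSeries.X ^ (2 * (D - i))) =
        c := by
    rw [map_sum, Finset.sum_eq_single D]
    · rw [map_mul, map_mul, map_pow, map_pow, PowerSeries.constantCoeff_C, constantCoeff_formalXMulSq,
        one_pow, mul_one, Nat.sub_self, mul_zero, pow_zero, mul_one]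
      rfl
    · intro i hi hne
      rw [Finset.mem_range] at hi
      have hpos : 2 * (D - i) ≠ 0 := by omega
      rw [map_mul, map_pow, PowerSeries.constantCoeff_X, zero_pow hpos, mul_zero]
    · intro hnot
      exact absurd (Finset.mem_range.mpr (Nat.lt_succ_self _)) hnot
  -- compare the coefficients of `z^{2(ℓ²-1-D)+2}`
  rw [hL, hR, mul_assoc, mul_assoc, ← mul_assoc _ (PowerSeries.X ^ 2), mul_comm _ (PowerSeries.X ^ 2),
    ← mul_assoc, ← mul_assoc, ← pow_add, mul_assoc] at key
  by_contra hlt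
  have e : ¬ 2 * ℓ ≤ 2 * (ℓ ^ 2 - 1 - D) + 2 := by omega
  have h2 := congrArg (PowerSeries.coeff (2 * (ℓ ^ 2 - 1 - D) + 2)) key
  rw [PowerSeries.coeff_X_pow_mul', if_pos le_rfl, Nat.sub_self,
    PowerSeries.coeff_zero_eq_constantCoeff_apply, map_mul, hB0, hu1, mul_one,
    PowerSeries.coeff_X_pow_mul', if_neg e] at h2
  exact hc0 h2

/-- **The key lemma, universally**: for an odd prime `N`, the coefficients of the `N`-division
polynomial `preΨ'_N` of the universal Weierstrass equation over `ℤ[a₁, a₂, a₃, a₄, a₆]` in degrees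
`i > (N² - N)/2` are divisible by `N` — over the domain `𝔽_N[aᵢ]` of characteristic `N`,
`(preΨ'_N)² = ΨSq_N` has degree `≤ N² - N`. (Katz–Mazur 12.4.2: `ψ_N mod N` has degree
`(N² - N)/2`.) [cite: SilvermanAEC2009, Exercise 3.7 and IV.4.4] -/
private theorem C_dvd_coeff_preΨ'_universalInt (N : ℕ) [hN : Fact N.Prime] (hN2 : N ≠ 2) {i : ℕ}
    (hi : N ^ 2 - N < 2 * i) :
    MvPolynomial.C (N : ℤ) ∣ (universalInt.preΨ' N).coeff i := by
  rw [MvPolynomial.C_dvd_iff_zmod]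
  have hodd : ¬Even N := Nat.not_even_iff_odd.mpr (hN.out.odd_of_ne_two hN2)
  have h1 : MvPolynomial.map (Int.castRingHom (ZMod N)) ((universalInt.preΨ' N).coeff i) =
      ((universalInt.map (MvPolynomial.map (σ := Fin 5) (Int.castRingHom (ZMod N)))).preΨ' N).coeff
        i := by
    rw [map_preΨ', Polynomial.coeff_map]
  rw [h1]
  apply Polynomial.coeff_eq_zero_of_natDegree_lt
  have hdeg := natDegree_ΨSq_le_of_charP N
    (universalInt.map (MvPolynomial.map (σ := Fin 5) (Int.castRingHom (ZMod N)))) hN2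
  rw [ΨSq_ofNat, if_neg hodd, mul_one, Polynomial.natDegree_pow] at hdeg
  omega

/-- **The key lemma over every commutative ring**: for an odd prime `N` and every Weierstrass
equation `W`, the coefficients of `preΨ'_N` in degrees `i > (N² - N)/2` are multiples of `N`
(specialise the universal statement along `ℤ[aᵢ] → R`). [cite: SilvermanAEC2009, Exercise 3.7 and IV.4.4] -/
private theorem exists_coeff_preΨ'_eq_natCast_mul {R : Type*} [CommRing R] (W : WeierstrassCurve R)
    (N : ℕ) [Fact N.Prime] (hN2 : N ≠ 2) {i : ℕ} (hi : N ^ 2 - N < 2 * i) :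
    ∃ q : R, (W.preΨ' N).coeff i = N * q := by
  obtain ⟨q, hq⟩ := C_dvd_coeff_preΨ'_universalInt N hN2 hi
  refine ⟨W.universalEval q, ?_⟩
  have hW : W.preΨ' N = (universalInt.preΨ' N).map W.universalEval := by
    rw [← map_preΨ', universalInt_map]
  rw [hW, Polynomial.coeff_map, hq, map_mul, map_natCast, map_natCast]

/-- **Crude bound on the parameter of a torsion point of the residue characteristic** (Mazur
1978, proof of Prop. 5.1; the Newton-polygon estimate `ord z ≤ ord N/(N-1)`): for a `w`-integral
Weierstrass equation, an odd prime `N` (nonzero in `F`) and an affine `N`-torsion point `(x, y)`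
of the kernel of reduction (`|x| > 1`), `|N| ≤ |z|^{N-1}` with `z = -x/y`. `x` is a root of
`preΨ'_N = N X^{(N²-1)/2} + ⋯`, whose coefficients are integral and, in degrees `> (N² - N)/2`,
multiples of `N` (`exists_coeff_preΨ'_eq_natCast_mul`); so a term of degree `≤ (N² - N)/2`
balances the top term: `|N| |x|^{(N-1)/2} ≤ 1`, and `|x| |z|² = 1`.
[cite: SilvermanAEC2009, Exercise 3.7 and IV.4.4] -/
theorem stub_crudeBound {F : Type*} [Field F] {w : Valuation F ℝ≥0} {V : WeierstrassCurve F}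
    [V.IsIntegral w.integer] (N : ℕ) [Fact N.Prime] (hN2 : N ≠ 2) (hNF : (N : F) ≠ 0)
    {x y : F} {h : V.toAffine.Nonsingular x y} (hx : 1 < w x)
    (hN : (N : ℤ) • (Affine.Point.some x y h : V.toAffine.Point) = 0) :
    w (N : F) ≤ w (-x / y) ^ (N - 1) := by
  have hNp : N.Prime := Fact.out
  obtain ⟨k, hk⟩ : Odd N := hNp.odd_of_ne_two hN2
  have hNeven : ¬Even N := Nat.not_even_iff_odd.mpr ⟨k, hk⟩
  -- index arithmetic: `D = (N²-1)/2 = 2k²+2k`, `(N²-N)/2 = 2k²+k`, `N - 1 = 2k`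
  have hD : (N ^ 2 - 1) / 2 = 2 * k ^ 2 + 2 * k := by
    have e : N ^ 2 = 2 * (2 * k ^ 2 + 2 * k) + 1 := by rw [hk]; ring
    rw [e, Nat.add_sub_cancel, Nat.mul_div_cancel_left _ two_pos]
  have hM : N ^ 2 - N = 2 * (2 * k ^ 2 + k) := by
    have e : N ^ 2 = 2 * (2 * k ^ 2 + k) + N := by rw [hk]; ring
    omega
  -- (1) `preΨ'_N(x) = 0`
  have hpre : (V.preΨ' N).eval x = 0 := by
    have h1 : (V.ΨSq N).eval x = 0 := (V.zsmul_some_eq_zero_iff_eval_ΨSq h N).mp hN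
    rw [ΨSq_ofNat, if_neg hNeven, mul_one, Polynomial.eval_pow] at h1
    exact (pow_eq_zero_iff two_ne_zero).mp h1
  -- (2) integrality of the coefficients, and divisibility by `N` above degree `(N²-N)/2`
  obtain ⟨V₀, hV₀⟩ : ∃ V₀ : WeierstrassCurve w.integer, V = V₀.baseChange F :=
    WeierstrassCurve.IsIntegral.integral
  have hcoe : ∀ i, (V.preΨ' N).coeff i = (((V₀.preΨ' N).coeff i : w.integer) : F) := fun i => by
    rw [hV₀, baseChange, map_preΨ', Polynomial.coeff_map]
    rfl
  have hint : ∀ i, w ((V.preΨ' N).coeff i) ≤ 1 := fun i => by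
    rw [hcoe]
    exact (w.mem_integer_iff _).mp ((V₀.preΨ' N).coeff i).2
  have hdiv : ∀ i, N ^ 2 - N < 2 * i → w ((V.preΨ' N).coeff i) ≤ w (N : F) := fun i hi => by
    obtain ⟨q, hq⟩ := exists_coeff_preΨ'_eq_natCast_mul V₀ N hN2 hi
    rw [hcoe, hq, Subring.coe_mul, Subring.coe_natCast, map_mul]
    exact mul_le_of_le_one_right' ((w.mem_integer_iff _).mp q.2)
  -- (3) the top term
  have hdeg : (V.preΨ' N).natDegree = 2 * k ^ 2 + 2 * k := by
    rw [V.natDegree_preΨ' hNF, if_neg hNeven, hD]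
  have htop : (V.preΨ' N).coeff (2 * k ^ 2 + 2 * k) = N := by
    have := V.coeff_preΨ' N
    simp only [if_neg hNeven, hD] at this
    exact_mod_cast this
  have hwx0 : w x ≠ 0 := ne_of_gt (lt_trans zero_lt_one hx)
  have hwN0 : w (N : F) ≠ 0 := (Valuation.ne_zero_iff w).mpr hNF
  have hg0 : w (N : F) * w x ^ (2 * k ^ 2 + 2 * k) ≠ 0 := mul_ne_zero hwN0 (pow_ne_zero _ hwx0)
  -- `preΨ'_N(x)` as a finite sum
  have hsum : ∑ i ∈ Finset.range (2 * k ^ 2 + 2 * k), (V.preΨ' N).coeff i * x ^ i +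
      (N : F) * x ^ (2 * k ^ 2 + 2 * k) = 0 := by
    have := hpre
    rw [Polynomial.eval_eq_sum_range, hdeg, Finset.sum_range_succ, htop] at this
    exact this
  -- some lower term reaches the valuation of the top term
  obtain ⟨i, hiD, hi⟩ : ∃ i ∈ Finset.range (2 * k ^ 2 + 2 * k),
      w (N : F) * w x ^ (2 * k ^ 2 + 2 * k) ≤ w ((V.preΨ' N).coeff i * x ^ i) := by
    by_contra hcon
    push Not at hcon
    have hlt : w (∑ i ∈ Finset.range (2 * k ^ 2 + 2 * k), (V.preΨ' N).coeff i * x ^ i) <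
        w ((N : F) * x ^ (2 * k ^ 2 + 2 * k)) := by
      rw [map_mul, map_pow]
      exact w.map_sum_lt hg0 hcon
    have := w.map_add_eq_of_lt_right hlt
    rw [hsum, map_zero, map_mul, map_pow] at this
    exact hg0 this.symm
  rw [Finset.mem_range] at hiD
  -- `i ≤ (N²-N)/2`: the terms of degree in `((N²-N)/2, D)` are strictly dominated
  have hiM : i ≤ 2 * k ^ 2 + k := by
    by_contra hlt
    have hlt' : N ^ 2 - N < 2 * i := by omega
    have h1 : w ((V.preΨ' N).coeff i * x ^ i) < w (N : F) * w x ^ (2 * k ^ 2 + 2 * k) := by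
      rw [map_mul, map_pow]
      calc w ((V.preΨ' N).coeff i) * w x ^ i ≤ w (N : F) * w x ^ i :=
            mul_le_mul_left (hdiv i hlt') _
        _ < w (N : F) * w x ^ (2 * k ^ 2 + 2 * k) :=
            mul_lt_mul_of_pos_left (pow_lt_pow_right₀ hx hiD) (pos_iff_ne_zero.mpr hwN0)
    exact absurd hi (not_le.mpr h1)
  -- `|N| |x|^D ≤ |x|^i ≤ |x|^{(N²-N)/2}`
  have h2 : w (N : F) * w x ^ (2 * k ^ 2 + 2 * k) ≤ w x ^ (2 * k ^ 2 + k) :=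
    calc w (N : F) * w x ^ (2 * k ^ 2 + 2 * k) ≤ w ((V.preΨ' N).coeff i * x ^ i) := hi
      _ = w ((V.preΨ' N).coeff i) * w x ^ i := by rw [map_mul, map_pow]
      _ ≤ w x ^ i := mul_le_of_le_one_left' (hint i)
      _ ≤ w x ^ (2 * k ^ 2 + k) := pow_le_pow_right₀ hx.le hiM
  -- cancel `|x|^{(N²-N)/2}`: `|N| |x|^k ≤ 1`
  have h3 : w (N : F) * w x ^ k ≤ 1 := by
    have hxM0 : w x ^ (2 * k ^ 2 + k) ≠ 0 := pow_ne_zero _ hwx0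
    have e : 2 * k ^ 2 + 2 * k = 2 * k ^ 2 + k + k := by ring
    rw [e, pow_add, ← mul_assoc, mul_comm (w (N : F)), mul_assoc] at h2
    calc w (N : F) * w x ^ k
        = (w x ^ (2 * k ^ 2 + k))⁻¹ * (w x ^ (2 * k ^ 2 + k) * (w (N : F) * w x ^ k)) := by
          rw [← mul_assoc, inv_mul_cancel₀ hxM0, one_mul]
      _ ≤ (w x ^ (2 * k ^ 2 + k))⁻¹ * w x ^ (2 * k ^ 2 + k) := mul_le_mul_right h2 _
      _ = 1 := inv_mul_cancel₀ hxM0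
  -- (4) `|x| |z|² = 1` on the kernel of reduction
  have hz := (FormalGroupChart.val_X_mul_val_zCoord_sq (FormalGroupChart.some_mem_kernel h hx)).1
  have hNsub : N - 1 = 2 * k := by omega
  rw [hNsub]
  calc w (N : F) = w (N : F) * w x ^ k * (w (-x / y) ^ 2) ^ k := by
        rw [mul_assoc, ← mul_pow, hz, one_pow, mul_one]
    _ ≤ 1 * (w (-x / y) ^ 2) ^ k := mul_le_mul_left h3 _
    _ = w (-x / y) ^ (2 * k) := by rw [one_mul, pow_mul]

end Summit.ABC.ABC.Theorems

end
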